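import Mathlib
import Summits.ValiantsHypothesis.ValiantsHypothesis.Theorems.KPlusLogSqLawStepTerminalMirror

/-!
# Continuation law, positive form (law C) and its reversal (law C′) at window level

Static path model of route `KPlusLogSqLaw` (lines `S_t(θ) = b t + s t * θ`, uppers = even indices,
window `[j, j+d]` separated at `θ` iff every odd line of the window lies strictly below every even
line of the window at `θ`; row `j` STEPS iff windows `j` and `j+1` are both separated somewhere and
never at a common point).  Helper theorems for the PLATEAU LENGTH LAW programme (zero crux credit;
nothing here bears on `TropicalB` as evidence).

* `toward_even` / `toward_odd` (LAW C, positive form): if rows `i` and `i+1` both step, the step at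
  row `i` moves TOWARD the natural side of row `i`: for even `i`, `s (i+1) < s i` forces a LEFT move
  (every point separating window `i+1` lies left of every point separating window `i`) and
  `s i < s (i+1)` a RIGHT move; for odd `i` the two slope conditions are exchanged.  This is the
  contrapositive of the terminal law `away_step_terminal_*` combined with the direction dichotomy of
  `step_slopes_*`.
* `sep_rev` (REVERSAL): the configuration `t ↦ -S_{M-t}` (`M` odd) has window `[lo, hi]` separated
  at `θ` iff the original has window `[M-hi, M-lo]` separated at `θ`.
* `toward_rev_even` / `toward_rev_odd` (LAW C′ = law C of the reversed configuration): if rows `i`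
  and `i+1` both step, the direction of row `i+1` is read off the two far lines `i+d+1`, `i+d+2`:
  for even `i`, `s (i+d+2) < s (i+d+1)` forces a RIGHT move of row `i+1` and
  `s (i+d+1) < s (i+d+2)` a LEFT move; for odd `i` exchanged.

Together with the FOUR-STEP LAW these are the inputs of the pencil proof of the length bound
`k ≤ d+2` (period-`d` antisymmetry); see the cell's THEORY-NOTE-g22 §1, §1quater.
-/

set_option linter.dupNamespace false

namespace Summit.ValiantsHypothesis.ValiantsHypothesis.Theorems.KPlusLogSqLawStepToward

open Summit.ValiantsHypothesis.ValiantsHypothesis.Theorems.KPlusLogSqLawStepSlopes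
  (step_slopes_even step_slopes_odd)
open Summit.ValiantsHypothesis.ValiantsHypothesis.Theorems.KPlusLogSqLawStepTerminal
  (away_step_terminal_even away_step_terminal_odd)
open Summit.ValiantsHypothesis.ValiantsHypothesis.Theorems.KPlusLogSqLawStepTerminalMirror
  (away_step_terminal_even_mirror away_step_terminal_odd_mirror)

/-- LAW C, even row `i`: if rows `i` and `i+1` both step (odd reach `d`), then
`s (i+1) < s i` forces the step at row `i` to move left and `s i < s (i+1)` forces it to move right. -/
theorem toward_even (s b : ℕ → ℝ) (i d : ℕ) (hi : Even i) (hd : Odd d)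
    (hA : ∃ θ : ℝ, ∀ e o : ℕ, i ≤ e → e ≤ i + d → i ≤ o → o ≤ i + d → Even e → Odd o →
      b o + s o * θ < b e + s e * θ)
    (hB : ∃ θ : ℝ, ∀ e o : ℕ, i + 1 ≤ e → e ≤ i + d + 1 → i + 1 ≤ o → o ≤ i + d + 1 → Even e → Odd o →
      b o + s o * θ < b e + s e * θ)
    (hAB : ∀ θ : ℝ, ¬ ((∀ e o : ℕ, i ≤ e → e ≤ i + d → i ≤ o → o ≤ i + d → Even e → Odd o →
      b o + s o * θ < b e + s e * θ) ∧ (∀ e o : ℕ, i + 1 ≤ e → e ≤ i + d + 1 → i + 1 ≤ o → o ≤ i + d + 1 →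
      Even e → Odd o → b o + s o * θ < b e + s e * θ)))
    (hB' : ∃ θ : ℝ, ∀ e o : ℕ, i + 2 ≤ e → e ≤ i + d + 2 → i + 2 ≤ o → o ≤ i + d + 2 → Even e → Odd o →
      b o + s o * θ < b e + s e * θ)
    (hBB' : ∀ θ : ℝ, ¬ ((∀ e o : ℕ, i + 1 ≤ e → e ≤ i + d + 1 → i + 1 ≤ o → o ≤ i + d + 1 → Even e →
      Odd o → b o + s o * θ < b e + s e * θ) ∧ (∀ e o : ℕ, i + 2 ≤ e → e ≤ i + d + 2 → i + 2 ≤ o →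
      o ≤ i + d + 2 → Even e → Odd o → b o + s o * θ < b e + s e * θ))) :
    (s (i + 1) < s i → ∀ θ θ' : ℝ, (∀ e o : ℕ, i ≤ e → e ≤ i + d → i ≤ o → o ≤ i + d → Even e → Odd o →
      b o + s o * θ < b e + s e * θ) → (∀ e o : ℕ, i + 1 ≤ e → e ≤ i + d + 1 → i + 1 ≤ o → o ≤ i + d + 1 →
      Even e → Odd o → b o + s o * θ' < b e + s e * θ') → θ' < θ) ∧
    (s i < s (i + 1) → ∀ θ θ' : ℝ, (∀ e o : ℕ, i ≤ e → e ≤ i + d → i ≤ o → o ≤ i + d → Even e → Odd o →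
      b o + s o * θ < b e + s e * θ) → (∀ e o : ℕ, i + 1 ≤ e → e ≤ i + d + 1 → i + 1 ≤ o → o ≤ i + d + 1 →
      Even e → Odd o → b o + s o * θ' < b e + s e * θ') → θ < θ') := by
  obtain ⟨o, o', -, -, -, -, -, -, hdir⟩ := step_slopes_even s b i d hi hd hA hB hAB
  constructor
  · intro hnat θ θ' hθ hθ'
    rcases hdir with ⟨-, -, hR⟩ | ⟨-, -, hL⟩
    · obtain ⟨x, hx1, hx2⟩ := away_step_terminal_even s b i d hi hd hnat hA hB hAB hR hB'
      exact absurd ⟨hx1, hx2⟩ (hBB' x)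
    · exact hL θ θ' hθ hθ'
  · intro hnat θ θ' hθ hθ'
    rcases hdir with ⟨-, -, hR⟩ | ⟨-, -, hL⟩
    · exact hR θ θ' hθ hθ'
    · obtain ⟨x, hx1, hx2⟩ := away_step_terminal_even_mirror s b i d hi hd hnat hA hB hAB hL hB'
      exact absurd ⟨hx1, hx2⟩ (hBB' x)

/-- LAW C, odd row `i`: if rows `i` and `i+1` both step (odd reach `d`), then
`s i < s (i+1)` forces the step at row `i` to move left and `s (i+1) < s i` forces it to move right. -/
theorem toward_odd (s b : ℕ → ℝ) (i d : ℕ) (hi : Odd i) (hd : Odd d)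
    (hA : ∃ θ : ℝ, ∀ e o : ℕ, i ≤ e → e ≤ i + d → i ≤ o → o ≤ i + d → Even e → Odd o →
      b o + s o * θ < b e + s e * θ)
    (hB : ∃ θ : ℝ, ∀ e o : ℕ, i + 1 ≤ e → e ≤ i + d + 1 → i + 1 ≤ o → o ≤ i + d + 1 → Even e → Odd o →
      b o + s o * θ < b e + s e * θ)
    (hAB : ∀ θ : ℝ, ¬ ((∀ e o : ℕ, i ≤ e → e ≤ i + d → i ≤ o → o ≤ i + d → Even e → Odd o →
      b o + s o * θ < b e + s e * θ) ∧ (∀ e o : ℕ, i + 1 ≤ e → e ≤ i + d + 1 → i + 1 ≤ o → o ≤ i + d + 1 →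
      Even e → Odd o → b o + s o * θ < b e + s e * θ)))
    (hB' : ∃ θ : ℝ, ∀ e o : ℕ, i + 2 ≤ e → e ≤ i + d + 2 → i + 2 ≤ o → o ≤ i + d + 2 → Even e → Odd o →
      b o + s o * θ < b e + s e * θ)
    (hBB' : ∀ θ : ℝ, ¬ ((∀ e o : ℕ, i + 1 ≤ e → e ≤ i + d + 1 → i + 1 ≤ o → o ≤ i + d + 1 → Even e →
      Odd o → b o + s o * θ < b e + s e * θ) ∧ (∀ e o : ℕ, i + 2 ≤ e → e ≤ i + d + 2 → i + 2 ≤ o →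
      o ≤ i + d + 2 → Even e → Odd o → b o + s o * θ < b e + s e * θ))) :
    (s i < s (i + 1) → ∀ θ θ' : ℝ, (∀ e o : ℕ, i ≤ e → e ≤ i + d → i ≤ o → o ≤ i + d → Even e → Odd o →
      b o + s o * θ < b e + s e * θ) → (∀ e o : ℕ, i + 1 ≤ e → e ≤ i + d + 1 → i + 1 ≤ o → o ≤ i + d + 1 →
      Even e → Odd o → b o + s o * θ' < b e + s e * θ') → θ' < θ) ∧
    (s (i + 1) < s i → ∀ θ θ' : ℝ, (∀ e o : ℕ, i ≤ e → e ≤ i + d → i ≤ o → o ≤ i + d → Even e → Odd o →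
      b o + s o * θ < b e + s e * θ) → (∀ e o : ℕ, i + 1 ≤ e → e ≤ i + d + 1 → i + 1 ≤ o → o ≤ i + d + 1 →
      Even e → Odd o → b o + s o * θ' < b e + s e * θ') → θ < θ') := by
  obtain ⟨e, e', -, -, -, -, -, -, hdir⟩ := step_slopes_odd s b i d hi hd hA hB hAB
  constructor
  · intro hnat θ θ' hθ hθ'
    rcases hdir with ⟨-, -, hR⟩ | ⟨-, -, hL⟩
    · obtain ⟨x, hx1, hx2⟩ := away_step_terminal_odd s b i d hi hd hnat hA hB hAB hR hB'
      exact absurd ⟨hx1, hx2⟩ (hBB' x)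
    · exact hL θ θ' hθ hθ'
  · intro hnat θ θ' hθ hθ'
    rcases hdir with ⟨-, -, hR⟩ | ⟨-, -, hL⟩
    · exact hR θ θ' hθ hθ'
    · obtain ⟨x, hx1, hx2⟩ := away_step_terminal_odd_mirror s b i d hi hd hnat hA hB hAB hL hB'
      exact absurd ⟨hx1, hx2⟩ (hBB' x)

/-- REVERSAL of a configuration: for odd `M`, the lines `t ↦ (-s (M-t), -b (M-t))` have window
`[lo, hi]` separated at `θ` iff the original lines have window `[lo', hi'] = [M-hi, M-lo]` separated
at `θ` (classes are exchanged by `t ↦ M-t` and exchanged back by the sign change). -/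
theorem sep_rev (s b : ℕ → ℝ) (M lo hi lo' hi' : ℕ) (hM : Odd M) (h1 : lo' + hi = M)
    (h2 : hi' + lo = M) (θ : ℝ) :
    (∀ e o : ℕ, lo ≤ e → e ≤ hi → lo ≤ o → o ≤ hi → Even e → Odd o →
      -b (M - o) + -s (M - o) * θ < -b (M - e) + -s (M - e) * θ) ↔
    (∀ e o : ℕ, lo' ≤ e → e ≤ hi' → lo' ≤ o → o ≤ hi' → Even e → Odd o →
      b o + s o * θ < b e + s e * θ) := by
  obtain ⟨m, hm⟩ := hM
  constructor
  · intro h e o g1 g2 g3 g4 he ho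
    obtain ⟨c, hc⟩ := he
    obtain ⟨c', hc'⟩ := ho
    have hev : Even (M - o) := ⟨m - c', by omega⟩
    have hod : Odd (M - e) := ⟨m - c, by omega⟩
    have key := h (M - o) (M - e) (by omega) (by omega) (by omega) (by omega) hev hod
    have r1 : M - (M - e) = e := by omega
    have r2 : M - (M - o) = o := by omega
    rw [r1, r2] at key
    linarith
  · intro h e o g1 g2 g3 g4 he ho
    obtain ⟨c, hc⟩ := he
    obtain ⟨c', hc'⟩ := ho
    have hev : Even (M - o) := ⟨m - c', by omega⟩
    have hod : Odd (M - e) := ⟨m - c, by omega⟩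
    have key := h (M - o) (M - e) (by omega) (by omega) (by omega) (by omega) hev hod
    linarith

/-- LAW C′, even row `i`: if rows `i` and `i+1` both step (odd reach `d`), then
`s (i+d+2) < s (i+d+1)` forces the step at row `i+1` to move right and `s (i+d+1) < s (i+d+2)`
forces it to move left (law C applied to the reversed configuration `t ↦ -S_{2i+d+2-t}`). -/
theorem toward_rev_even (s b : ℕ → ℝ) (i d : ℕ) (hi : Even i) (hd : Odd d)
    (hA : ∃ θ : ℝ, ∀ e o : ℕ, i ≤ e → e ≤ i + d → i ≤ o → o ≤ i + d → Even e → Odd o →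
      b o + s o * θ < b e + s e * θ)
    (hB : ∃ θ : ℝ, ∀ e o : ℕ, i + 1 ≤ e → e ≤ i + d + 1 → i + 1 ≤ o → o ≤ i + d + 1 → Even e → Odd o →
      b o + s o * θ < b e + s e * θ)
    (hAB : ∀ θ : ℝ, ¬ ((∀ e o : ℕ, i ≤ e → e ≤ i + d → i ≤ o → o ≤ i + d → Even e → Odd o →
      b o + s o * θ < b e + s e * θ) ∧ (∀ e o : ℕ, i + 1 ≤ e → e ≤ i + d + 1 → i + 1 ≤ o → o ≤ i + d + 1 →
      Even e → Odd o → b o + s o * θ < b e + s e * θ)))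
    (hB' : ∃ θ : ℝ, ∀ e o : ℕ, i + 2 ≤ e → e ≤ i + d + 2 → i + 2 ≤ o → o ≤ i + d + 2 → Even e → Odd o →
      b o + s o * θ < b e + s e * θ)
    (hBB' : ∀ θ : ℝ, ¬ ((∀ e o : ℕ, i + 1 ≤ e → e ≤ i + d + 1 → i + 1 ≤ o → o ≤ i + d + 1 → Even e →
      Odd o → b o + s o * θ < b e + s e * θ) ∧ (∀ e o : ℕ, i + 2 ≤ e → e ≤ i + d + 2 → i + 2 ≤ o →
      o ≤ i + d + 2 → Even e → Odd o → b o + s o * θ < b e + s e * θ))) :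
    (s (i + d + 2) < s (i + d + 1) → ∀ θ θ' : ℝ, (∀ e o : ℕ, i + 1 ≤ e → e ≤ i + d + 1 → i + 1 ≤ o →
      o ≤ i + d + 1 → Even e → Odd o → b o + s o * θ < b e + s e * θ) → (∀ e o : ℕ, i + 2 ≤ e →
      e ≤ i + d + 2 → i + 2 ≤ o → o ≤ i + d + 2 → Even e → Odd o → b o + s o * θ' < b e + s e * θ') →
      θ < θ') ∧
    (s (i + d + 1) < s (i + d + 2) → ∀ θ θ' : ℝ, (∀ e o : ℕ, i + 1 ≤ e → e ≤ i + d + 1 → i + 1 ≤ o →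
      o ≤ i + d + 1 → Even e → Odd o → b o + s o * θ < b e + s e * θ) → (∀ e o : ℕ, i + 2 ≤ e →
      e ≤ i + d + 2 → i + 2 ≤ o → o ≤ i + d + 2 → Even e → Odd o → b o + s o * θ' < b e + s e * θ') →
      θ' < θ) := by
  obtain ⟨M, hM⟩ : ∃ M : ℕ, M = i + (i + d + 2) := ⟨_, rfl⟩
  have hMo : Odd M := by
    obtain ⟨k, hk⟩ := hi
    obtain ⟨l, hl⟩ := hd
    exact ⟨i + l + 1, by omega⟩
  -- the three windows of the reversed configuration
  have R0 := sep_rev s b M i (i + d) (i + 2) (i + d + 2) hMo (by omega) (by omega)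
  have R1 := sep_rev s b M (i + 1) (i + d + 1) (i + 1) (i + d + 1) hMo (by omega) (by omega)
  have R2 := sep_rev s b M (i + 2) (i + d + 2) i (i + d) hMo (by omega) (by omega)
  obtain ⟨θA, hθA⟩ := hA
  obtain ⟨θB, hθB⟩ := hB
  obtain ⟨θB', hθB'⟩ := hB'
  have T := toward_even (fun t => -s (M - t)) (fun t => -b (M - t)) i d hi hd
    ⟨θB', (R0 θB').mpr hθB'⟩ ⟨θB, (R1 θB).mpr hθB⟩
    (fun θ h => hBB' θ ⟨(R1 θ).mp h.2, (R0 θ).mp h.1⟩)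
    ⟨θA, (R2 θA).mpr hθA⟩
    (fun θ h => hAB θ ⟨(R2 θ).mp h.2, (R1 θ).mp h.1⟩)
  have e1 : M - (i + 1) = i + d + 1 := by omega
  have e2 : M - i = i + d + 2 := by omega
  constructor
  · intro hnat θ θ' hθ hθ'
    have hnat' : (fun t => -s (M - t)) (i + 1) < (fun t => -s (M - t)) i := by
      show -s (M - (i + 1)) < -s (M - i)
      rw [e1, e2]
      linarith
    exact T.1 hnat' θ' θ ((R0 θ').mpr hθ') ((R1 θ).mpr hθ)
  · intro hnat θ θ' hθ hθ'
    have hnat' : (fun t => -s (M - t)) i < (fun t => -s (M - t)) (i + 1) := by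
      show -s (M - i) < -s (M - (i + 1))
      rw [e1, e2]
      linarith
    exact T.2 hnat' θ' θ ((R0 θ').mpr hθ') ((R1 θ).mpr hθ)

/-- LAW C′, odd row `i`: if rows `i` and `i+1` both step (odd reach `d`), then
`s (i+d+1) < s (i+d+2)` forces the step at row `i+1` to move right and `s (i+d+2) < s (i+d+1)`
forces it to move left. -/
theorem toward_rev_odd (s b : ℕ → ℝ) (i d : ℕ) (hi : Odd i) (hd : Odd d)
    (hA : ∃ θ : ℝ, ∀ e o : ℕ, i ≤ e → e ≤ i + d → i ≤ o → o ≤ i + d → Even e → Odd o →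
      b o + s o * θ < b e + s e * θ)
    (hB : ∃ θ : ℝ, ∀ e o : ℕ, i + 1 ≤ e → e ≤ i + d + 1 → i + 1 ≤ o → o ≤ i + d + 1 → Even e → Odd o →
      b o + s o * θ < b e + s e * θ)
    (hAB : ∀ θ : ℝ, ¬ ((∀ e o : ℕ, i ≤ e → e ≤ i + d → i ≤ o → o ≤ i + d → Even e → Odd o →
      b o + s o * θ < b e + s e * θ) ∧ (∀ e o : ℕ, i + 1 ≤ e → e ≤ i + d + 1 → i + 1 ≤ o → o ≤ i + d + 1 →
      Even e → Odd o → b o + s o * θ < b e + s e * θ)))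
    (hB' : ∃ θ : ℝ, ∀ e o : ℕ, i + 2 ≤ e → e ≤ i + d + 2 → i + 2 ≤ o → o ≤ i + d + 2 → Even e → Odd o →
      b o + s o * θ < b e + s e * θ)
    (hBB' : ∀ θ : ℝ, ¬ ((∀ e o : ℕ, i + 1 ≤ e → e ≤ i + d + 1 → i + 1 ≤ o → o ≤ i + d + 1 → Even e →
      Odd o → b o + s o * θ < b e + s e * θ) ∧ (∀ e o : ℕ, i + 2 ≤ e → e ≤ i + d + 2 → i + 2 ≤ o →
      o ≤ i + d + 2 → Even e → Odd o → b o + s o * θ < b e + s e * θ))) :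
    (s (i + d + 1) < s (i + d + 2) → ∀ θ θ' : ℝ, (∀ e o : ℕ, i + 1 ≤ e → e ≤ i + d + 1 → i + 1 ≤ o →
      o ≤ i + d + 1 → Even e → Odd o → b o + s o * θ < b e + s e * θ) → (∀ e o : ℕ, i + 2 ≤ e →
      e ≤ i + d + 2 → i + 2 ≤ o → o ≤ i + d + 2 → Even e → Odd o → b o + s o * θ' < b e + s e * θ') →
      θ < θ') ∧
    (s (i + d + 2) < s (i + d + 1) → ∀ θ θ' : ℝ, (∀ e o : ℕ, i + 1 ≤ e → e ≤ i + d + 1 → i + 1 ≤ o →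
      o ≤ i + d + 1 → Even e → Odd o → b o + s o * θ < b e + s e * θ) → (∀ e o : ℕ, i + 2 ≤ e →
      e ≤ i + d + 2 → i + 2 ≤ o → o ≤ i + d + 2 → Even e → Odd o → b o + s o * θ' < b e + s e * θ') →
      θ' < θ) := by
  obtain ⟨M, hM⟩ : ∃ M : ℕ, M = i + (i + d + 2) := ⟨_, rfl⟩
  have hMo : Odd M := by
    obtain ⟨k, hk⟩ := hi
    obtain ⟨l, hl⟩ := hd
    exact ⟨i + l + 1, by omega⟩
  have R0 := sep_rev s b M i (i + d) (i + 2) (i + d + 2) hMo (by omega) (by omega)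
  have R1 := sep_rev s b M (i + 1) (i + d + 1) (i + 1) (i + d + 1) hMo (by omega) (by omega)
  have R2 := sep_rev s b M (i + 2) (i + d + 2) i (i + d) hMo (by omega) (by omega)
  obtain ⟨θA, hθA⟩ := hA
  obtain ⟨θB, hθB⟩ := hB
  obtain ⟨θB', hθB'⟩ := hB'
  have T := toward_odd (fun t => -s (M - t)) (fun t => -b (M - t)) i d hi hd
    ⟨θB', (R0 θB').mpr hθB'⟩ ⟨θB, (R1 θB).mpr hθB⟩
    (fun θ h => hBB' θ ⟨(R1 θ).mp h.2, (R0 θ).mp h.1⟩)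
    ⟨θA, (R2 θA).mpr hθA⟩
    (fun θ h => hAB θ ⟨(R2 θ).mp h.2, (R1 θ).mp h.1⟩)
  have e1 : M - (i + 1) = i + d + 1 := by omega
  have e2 : M - i = i + d + 2 := by omega
  constructor
  · intro hnat θ θ' hθ hθ'
    have hnat' : (fun t => -s (M - t)) i < (fun t => -s (M - t)) (i + 1) := by
      show -s (M - i) < -s (M - (i + 1))
      rw [e1, e2]
      linarith
    exact T.1 hnat' θ' θ ((R0 θ').mpr hθ') ((R1 θ).mpr hθ)
  · intro hnat θ θ' hθ hθ'
    have hnat' : (fun t => -s (M - t)) (i + 1) < (fun t => -s (M - t)) i := by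
      show -s (M - (i + 1)) < -s (M - i)
      rw [e1, e2]
      linarith
    exact T.2 hnat' θ' θ ((R0 θ').mpr hθ') ((R1 θ).mpr hθ)

end Summit.ValiantsHypothesis.ValiantsHypothesis.Theorems.KPlusLogSqLawStepToward
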